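import Summits.QuantumFields.BalabanUV.T4Continuum.Support.NE7StabiliserLiftingUniformEnd
import Summits.QuantumFields.BalabanUV.T4Continuum.Support.NE7SymmetricOpenOfMinimisation
import Summits.QuantumFields.BalabanUV.T4Continuum.Support.NE7AllMinimisersSmallGeneric
import HarnessLib

/-!
# NE7StabiliserLiftingUniformOfPath — THE `k`-UNIFORM STABILISER LIFTING MODULO ONE LETTER, (PATH_K): the symmetric open half (OPEN_K) of ✓ p828980
# `NE7StabiliserLiftingUniformEnd` is DISCHARGED by ✓ `NE7SymmetricOpenOfMinimisation.symmetric_hopen_of_ape_allSmall` with the road's (APE) ∧ (ALL-SMALL)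
# letters discharged, along `δ_V`-small data, by H10 ✓ `critical_is_minimiser_any_datum` and the (8)∀ theorem ✓ `all_minimisers_small_generic` — all radii `k`-FREE

Cell `pub-balaban`, rung (B)+1 sub-cell t4, lineage `b2b-balaban-t4-ne7b-p1` (row NE7b OWNER + CRUX PROVER; junction service for row NE7, ruling
R-OWNER-149-1 (2)), generation 159.  Memo `t4/b2b-balaban-t4-ne7b-p1/g159/records/SCOPING-uniform-lifting.md` (S6, partial: everything but (PATH_K)).
THE ASSEMBLY.  Radii `r₁ = (ε∕4)(L^{k+1})^{−2} < r = (ε∕2)(L^{k+1})^{−2} <` class radius.  Along a data path whose values are `δ_V`-small (`δ_V ≤` the (8)∀ radius of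
✓ `all_minimisers_small_generic`, `k`-free): (APE) «admissible, `SmallField · r`, tangent-critical ⇒ `SmallField · r₁`» holds because a tangent-critical admissible
configuration is a minimiser (H10, any datum) and every minimiser over a `δ_V`-small datum is `SmallField · (ε∕4)(L^{k+1})^{−2}` ((8)∀); (ALL-SMALL) «every admissible `U`
with action `≤` that of a small tangent-critical admissible `U₀` is `SmallField · r₁`» because `U₀` is a minimiser (H10), so `U` is one too, so (8)∀ applies.  Then
✓ `symmetric_hopen_of_ape_allSmall` gives (OPEN_K) for `K = Stab(V₀)`, and ✓ `stabiliser_lifting_uniform_of_open_path` gives the lifting.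
WHAT ([folklore]; 0 def, 0 sorry; `d = 4`, every `U(n)`, `L ≥ 2`).  **`stabiliser_lifting_uniform_of_path`**: `∃ ε₀ ∀ 0<ε≤ε₀ ∀ N≥1 ∃ δ_V>0 ∀ k ∀ V₀ ∀ γ`: IF `γ` is
continuous on `[0,1]` with `γ 1 = V₀`, values unitary, `N`-periodic, `SmallField · δ_V` and FIXED by every unitary `N`-periodic `s` fixing `V₀`, and `γ 0` FLAT, THEN every
minimiser `U` of `sfClass 4 L N ε` at level `k+1` over `V₀` and every unitary `N`-periodic `s` with `V₀^s = V₀` admit a unitary `(N·L^{k+1})`-periodic `h` with `U^h = U` and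
`h(L^{k+1}•z) = s(z)` — ✓ p824904's lifting with `∃ δ_V ∀ k`, MODULO the existence of such a path (letter (PATH_K): a `Stab(V₀)`-symmetric small-data path from a
symmetric flat datum; file S3 of the memo — F29's compactness inside the fixed set).
HONEST FRAMING (page 1): composition of landed kernel theorems; (PATH_K) is NOT proved here and is the ONE remaining hypothesis of the `k`-uniform lifting; nothing
of Bałaban's asserted; OUR minimisers ∕ OUR route; NOT NE7 as a spine node, NOT NE3; row NE7b NOT PRINTED ∕ NOT PROVED; spine 0∕9; finite T⁴ rung (B)+1 — NOT
infinite volume, NOT mass gap, NOT BetaPertH, NOT Clay (continuum YM on T⁴ ⇐ BetaPertH ∧ nine spine estimates).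
-/

set_option autoImplicit false

open scoped BigOperators Matrix Matrix.Norms.L2Operator Topology
open NormedSpace Finset Set Filter

namespace Summit.QuantumFields.BalabanUV.T4Continuum.NE7StabiliserLiftingUniformOfPath

open Literature.MathematicalPhysics.QuantumFieldTheory.Balaban1983to89
open B7Prop1Explicit B7Prop2Explicit
open T4AveragingDeficitWall (IsUnitaryCfg IsSkewDir SmallField)
open T4AveragingDeficitWallBoundary (IsPeriodicCfg)
open AveragingDeficitPeriodicCounting (IsPeriodicDir)
open AveragingDeficitMultiLevelPrep (LevelSmall TangentIter)
open MinimalActionLevels (perWin levelAction)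
open MinimalActionSandwich (IsMinimiser admissible)
open MinimalActionRate (sfClass)
open NE3HessForm (dAction)
open NE3EnergyShapes (IsUnitarySite IsPeriodicSite)
open NE7EnergyClassPoincareGeneric (classPackage)
open NE7CriticalOrbitAnyDatum (critical_is_minimiser_any_datum)
open NE7AllMinimisersSmallGeneric (all_minimisers_small_generic)
open NE7SymmetricOpenOfMinimisation (symmetric_hopen_of_ape_allSmall)
open NE7StabiliserLiftingUniformEnd (stabiliser_lifting_uniform_of_open_path)

noncomputable section

variable {n : Type} [Fintype n] [DecidableEq n]

/-- **`k`-UNIFORM STABILISER LIFTING MODULO (PATH_K)** (`d = 4`, every `U(n)`, `L ≥ 2`; statement in the module docstring). [folklore] -/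
theorem stabiliser_lifting_uniform_of_path [Nonempty n] {L : ℕ} (hL : 2 ≤ L) :
    ∃ ε₀ : ℝ, 0 < ε₀ ∧ ∀ ε : ℝ, 0 < ε → ε ≤ ε₀ → ∀ (N : ℕ) [NeZero N], 1 ≤ N → ∃ δV : ℝ, 0 < δV ∧
      ∀ (k : ℕ) (V₀ : Site 4 → Fin 4 → (Matrix n n ℂ)ˣ) (γ : ℝ → (Site 4 → Fin 4 → (Matrix n n ℂ)ˣ)),
        ContinuousOn γ (Icc (0 : ℝ) 1) → γ 1 = V₀ →
        (∀ τ ∈ Icc (0 : ℝ) 1, IsUnitaryCfg (γ τ) ∧ IsPeriodicCfg (γ τ) (N : ℤ) ∧ SmallField (γ τ) δV ∧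
          ∀ s : Site 4 → (Matrix n n ℂ)ˣ, IsUnitarySite s → IsPeriodicSite s (N : ℤ) → gaugeAct s V₀ = V₀ → gaugeAct s (γ τ) = γ τ) →
        SmallField (γ 0) 0 →
        ∀ U : Site 4 → Fin 4 → (Matrix n n ℂ)ˣ, IsMinimiser 4 (sfClass 4 L N ε) L N (k + 1) V₀ U →
        ∀ s : Site 4 → (Matrix n n ℂ)ˣ, IsUnitarySite s → IsPeriodicSite s (N : ℤ) → gaugeAct s V₀ = V₀ →
          ∃ h : Site 4 → (Matrix n n ℂ)ˣ, IsUnitarySite h ∧ IsPeriodicSite h ((N * L ^ (k + 1) : ℕ) : ℤ) ∧ gaugeAct h U = U ∧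
            ∀ z : Site 4, h (((L : ℤ) ^ (k + 1)) • z) = s z := by
  classical
  haveI : NeZero L := ⟨by omega⟩
  have hL1 : 1 ≤ L := by omega
  have hL0 : (0 : ℝ) < L := by exact_mod_cast (show 0 < L by omega)
  obtain ⟨ε₁, hε₁, HE⟩ := stabiliser_lifting_uniform_of_open_path (n := n) hL
  obtain ⟨εH, hεH, H10⟩ := critical_is_minimiser_any_datum (n := n) hL
  obtain ⟨ε₂, hε₂, HA⟩ := all_minimisers_small_generic (n := n) hL
  obtain ⟨θ₀, CF, CE, hθ₀, -, -, -, hC0θ, hDθ, hlsP, -, -⟩ := classPackage (n := n) (d := 4) (by norm_num) hL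
  refine ⟨min (min ε₁ εH) (min ε₂ θ₀), lt_min (lt_min hε₁ hεH) (lt_min hε₂ hθ₀), fun ε hε hεle N _ hN => ?_⟩
  have hε₁' : ε ≤ ε₁ := hεle.trans ((min_le_left _ _).trans (min_le_left _ _))
  have hεH' : ε ≤ εH := hεle.trans ((min_le_left _ _).trans (min_le_right _ _))
  have hε₂' : ε ≤ ε₂ := hεle.trans ((min_le_right _ _).trans (min_le_left _ _))
  have hεθ : ε ≤ θ₀ := hεle.trans ((min_le_right _ _).trans (min_le_right _ _))
  have hls : ∀ j : ℕ, LevelSmall 4 L j (ε / ((L : ℝ) ^ (j + 1)) ^ 2) := hlsP hε.le hεθ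
  have hε1 : 16 * C0 4 * ε ≤ 3 := (mul_le_mul_of_nonneg_left hεθ (by have := C0_pos 4; positivity)).trans hC0θ
  have hε2 : 1024 * ((4 : ℕ) + 1 : ℝ) * ((4 : ℕ) + 4 : ℝ) * (L : ℝ) ^ 2 * ε ≤ 1 :=
    (mul_le_mul_of_nonneg_left hεθ (by positivity)).trans hDθ
  obtain ⟨δ₁, hδ₁, HE1⟩ := HE ε hε hε₁' N hN
  obtain ⟨δ₂, hδ₂, HA2⟩ := HA ε hε hε₂' N hN
  refine ⟨min δ₁ δ₂, lt_min hδ₁ hδ₂, fun k V₀ γ hγ hγ1 hγdata hγ0 U hU s hsu hsP hsfix => ?_⟩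
  -- the symmetry set, the radii
  set K : Set (Site 4 → (Matrix n n ℂ)ˣ) := {s | IsUnitarySite s ∧ IsPeriodicSite s (N : ℤ) ∧ gaugeAct s V₀ = V₀} with hK
  have hKu : ∀ s ∈ K, IsUnitarySite s := fun s hs => hs.1
  have hKP : ∀ s ∈ K, IsPeriodicSite s (N : ℤ) := fun s hs => hs.2.1
  have hM0 : (0 : ℝ) < ((L : ℝ) ^ (k + 1)) ^ 2 := by positivity
  set r₁ : ℝ := (ε / 4) / ((L : ℝ) ^ (k + 1)) ^ 2 with hr₁
  set r : ℝ := (ε / 2) / ((L : ℝ) ^ (k + 1)) ^ 2 with hr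
  have hr₁0 : 0 ≤ r₁ := by positivity
  have hr₁r : r₁ < r := div_lt_div_of_pos_right (by linarith) hM0
  have hrε : r < ε / ((L : ℝ) ^ (k + 1)) ^ 2 := div_lt_div_of_pos_right (by linarith) hM0
  -- the path data
  have hγu : ∀ τ ∈ Icc (0 : ℝ) 1, IsUnitaryCfg (γ τ) := fun τ hτ => (hγdata τ hτ).1
  have hγP : ∀ τ ∈ Icc (0 : ℝ) 1, IsPeriodicCfg (γ τ) (N : ℤ) := fun τ hτ => (hγdata τ hτ).2.1
  have hγA : ∀ τ ∈ Icc (0 : ℝ) 1, γ τ ∈ {V : Site 4 → Fin 4 → (Matrix n n ℂ)ˣ | IsUnitaryCfg V ∧ IsPeriodicCfg V (N : ℤ) ∧ SmallField V δ₂} :=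
    fun τ hτ => ⟨(hγdata τ hτ).1, (hγdata τ hτ).2.1, MinimalActionRate.SmallField.mono (hγdata τ hτ).2.2.1 (min_le_right _ _)⟩
  have hγK : ∀ τ ∈ Icc (0 : ℝ) 1, ∀ s ∈ K, gaugeAct s (γ τ) = γ τ := fun τ hτ s hs => (hγdata τ hτ).2.2.2 s hs.1 hs.2.1 hs.2.2
  have hγdata' : ∀ τ ∈ Icc (0 : ℝ) 1, IsUnitaryCfg (γ τ) ∧ IsPeriodicCfg (γ τ) (N : ℤ) ∧ ∀ s ∈ K, gaugeAct s (γ τ) = γ τ :=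
    fun τ hτ => ⟨hγu τ hτ, hγP τ hτ, hγK τ hτ⟩
  have h1I : (1 : ℝ) ∈ Icc (0 : ℝ) 1 := ⟨zero_le_one, le_rfl⟩
  have hV₀δ : SmallField V₀ δ₁ := by
    have h := (hγdata 1 h1I).2.2.1
    rw [hγ1] at h
    exact MinimalActionRate.SmallField.mono h (min_le_left _ _)
  -- a tangent-critical admissible configuration over a path datum is a minimiser (H10), hence small ((8)∀)
  have hcritMin : ∀ τ ∈ Icc (0 : ℝ) 1, ∀ W ∈ admissible (sfClass 4 L N ε) L (k + 1) (γ τ),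
      (∀ φ : Site 4 → Fin 4 → Matrix n n ℂ, IsSkewDir φ → IsPeriodicDir φ ((N * L ^ (k + 1) : ℕ) : ℤ) → TangentIter L k W φ →
        dAction W φ (perWin 4 (N * L ^ (k + 1))) = 0) → IsMinimiser 4 (sfClass 4 L N ε) L N (k + 1) (γ τ) W := by
    intro τ _ W hW hcrit
    have hcrit' : ∀ j : ℕ, k + 1 = j + 1 → ∀ φ : Site 4 → Fin 4 → Matrix n n ℂ, IsSkewDir φ → IsPeriodicDir φ ((N * L ^ (j + 1) : ℕ) : ℤ) →
        TangentIter L j W φ → dAction W φ (perWin 4 (N * L ^ (j + 1))) = 0 := by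
      intro j hj φ hφs hφP hφT
      obtain rfl : k = j := by omega
      exact hcrit φ hφs hφP hφT
    exact (H10 ε hε hεH' N hN (γ τ) (k + 1) W hW hcrit').1
  have hape : ∀ τ ∈ Icc (0 : ℝ) 1, ∀ W ∈ admissible (sfClass 4 L N ε) L (k + 1) (γ τ), SmallField W r →
      (∀ φ : Site 4 → Fin 4 → Matrix n n ℂ, IsSkewDir φ → IsPeriodicDir φ ((N * L ^ (k + 1) : ℕ) : ℤ) → TangentIter L k W φ →
        dAction W φ (perWin 4 (N * L ^ (k + 1))) = 0) → SmallField W r₁ :=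
    fun τ hτ W hW _ hcrit => HA2 (γ τ) (hγA τ hτ) (k + 1) W (hcritMin τ hτ W hW hcrit)
  have hall : ∀ τ ∈ Icc (0 : ℝ) 1, ∀ W₀ ∈ admissible (sfClass 4 L N ε) L (k + 1) (γ τ), SmallField W₀ r₁ →
      (∀ φ : Site 4 → Fin 4 → Matrix n n ℂ, IsSkewDir φ → IsPeriodicDir φ ((N * L ^ (k + 1) : ℕ) : ℤ) → TangentIter L k W₀ φ →
        dAction W₀ φ (perWin 4 (N * L ^ (k + 1))) = 0) →
      ∀ W ∈ admissible (sfClass 4 L N ε) L (k + 1) (γ τ), levelAction 4 L N (k + 1) W ≤ levelAction 4 L N (k + 1) W₀ → SmallField W r₁ := by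
    intro τ hτ W₀ hW₀ _ hcrit W hW hle
    have hmin₀ := hcritMin τ hτ W₀ hW₀ hcrit
    have hminW : IsMinimiser 4 (sfClass 4 L N ε) L N (k + 1) (γ τ) W := ⟨hW, fun W' hW' => hle.trans (hmin₀.le W' hW')⟩
    exact HA2 (γ τ) (hγA τ hτ) (k + 1) W hminW
  -- (OPEN_K) by restricted minimisation, then the END
  have hopen := symmetric_hopen_of_ape_allSmall (d := 4) (n := n) hL hε.le hε1 hε2 (hls k) hr₁0 hr₁r hrε K hKu hKP γ hγ hγu hγP hγK hape hall
  exact HE1 k r (hr₁0.trans hr₁r.le) V₀ γ hV₀δ hγ hγ1 hγdata' hγ0 hopen U hU s hsu hsP hsfix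

end

end Summit.QuantumFields.BalabanUV.T4Continuum.NE7StabiliserLiftingUniformOfPath
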